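import Literature.AlgebraicGeometry.Frobenioids.ArchimedeanFSMFFTransfer
import Literature.AlgebraicGeometry.Frobenioids.ArchimedeanFSMFFPiecesN
import Literature.AlgebraicGeometry.Frobenioids.ArchimedeanFSMChainBound
import HarnessLib

/-!
# Frobenioids II, Proposition 3.4 (viii): "`N` is of FSMFF-type", assembled
# (abc-iut cell, layer L1, sub-nodes `FrdII:Prop3.4(viii)/P34-L13` + `/P34-L14` for the tower `towerN`)

Mochizuki, *The geometry of Frobenioids II: poly-Frobenioids*, Kyushu J. Math. **62** (2008)
401–460, §3, Proposition 3.4 (viii) p. 30, proof p. 33 [cite: MochizukiFrdII2008, Prop 3.4 (viii) p.33].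

PROOF-ONLY file (nothing is defined): the abstract assembly `FSMFFTransfer.exists_isFSMIChain_of_isFSM`
(`ArchimedeanFSMFFTransfer.lean`) instantiated at the non-rigidified angloid `N = N₀ ×_{D₀} D`
(`towerN π`) with the model pieces of `ArchimedeanFSMFFPiecesN.lean`, and combined with the chain bound
of `ArchimedeanFSMChainBound.lean`. What remains HYPOTHESIS, by name: the typed items (iii)
(`(towerN π).PropIII` — refuted as typed in general, proved in the complex regime,
`prop34_iii_of_isComplex`), (iv) (`PropIV`, proved: `prop34_iv_holds`) with "`D` complexifiable",
(v) (`PropV`, proved for `D` totally epimorphic: `N.propV`),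
(vii) (`PropVII`); condition (a) and (b) for `D` (`IsOfFSMFFType2024 D`); and the portion of (viii)
concerning `F₀ = N0` in the form the sub-nodes P34-L10–L12 deliver it: FSMI-morphisms of `N0` lie
over isomorphisms of `D₀` (`h10`), condition (a) of `N0` at arrows between image objects (`ha₀`),
condition (b) of `N0` at image objects (`hb₀`). No side is taken on [IUTchIII] Cor. 3.12.
-/

namespace Literature.AlgebraicGeometry.Frobenioids

open CategoryTheory

noncomputable section

namespace ArchFrd

universe v u

variable {D : Type u} [Category.{v} D] (π : D ⥤ D0)

/-- **[FrdII] Prop. 3.4 (viii) for `F = N`, condition (a)**: every FSM-morphism of the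
non-rigidified angloid `N = N₀ ×_{D₀} D` that is not an isomorphism is a composite of FSMI-morphisms — from
the typed items (iii), (iv) [+ `D` complexifiable], (v), (vii) [(vi) is proved: `N.propVI`], condition (a) for `D`, and the
`N0`-portion of (viii) (FSMI-morphisms of `N0` lie over isomorphisms of `D₀`; condition (a) of `N0` at
arrows between image objects), all BY NAME; the model pieces are those of
`ArchimedeanFSMFFPiecesN.lean`. [cite: MochizukiFrdII2008, Prop 3.4 (viii) p.33] -/
theorem N.exists_isFSMIChain_of_isFSM (hIII : (towerN π).PropIII) (hIV : (towerN π).PropIV)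
    (hc : RC.IsComplexifiable (π ⋙ D0.toArchBase)) (hV : (towerN π).PropV)
    (hVII : (towerN π).PropVII)
    (h10 : ∀ {U V : N0} (ε : U ⟶ V), IsFSMI ε → PreFrobenioid.IsBaseIso C0.toElem (N0.homCarrier ε))
    (haD : ∀ {X Y : D} (δ : X ⟶ Y), IsFSM δ → ¬ IsIso δ → ∃ n, IsFSMIChain δ n)
    (ha₀ : ∀ {X Z : (towerN π).F} (ψ₀ : (towerN π).toF0.obj X ⟶ (towerN π).toF0.obj Z),
      IsFSM ψ₀ → ¬ IsIso ψ₀ → ∃ n, IsFSMIChain ψ₀ n)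
    {X Y : (towerN π).F} (φ : X ⟶ Y) (hφ : IsFSM φ) (hφiso : ¬ IsIso φ) :
    ∃ n, IsFSMIChain φ n :=
  FSMFFTransfer.exists_isFSMIChain_of_isFSM (towerN π).toD (towerN π).toF0
    (fun {_ _} α => PreFrobenioid.IsPullbackMorphism C0.toElem (α.hom.hom.fst))
    (fun φ => N.exists_fac_pullback π φ)
    (fun α hP hD => N.mono_of_isPullbackMorphism_fst π α hP hD)
    (fun α hP hD => N.isIso_of_isPullbackMorphism_fst_of_isIso_snd π α hP hD)
    (fun ψ hD h0 => N.isIso_of_isIso_proj π ψ hD h0)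
    (fun φ hφ => hIII φ hφ)
    (fun β hG hβ => ((hIV hc β hG).1 hβ))
    (fun {_ _} β _ {_} ε χ hfac hε => N.exists_lift_toN0_fac π β ε χ hfac (h10 ε hε))
    (fun ψ hD h0 => N.mono_of_isIso_snd_of_mono_toN0 π ψ hD h0)
    (fun ψ hD hψ h0 => (towerN π).isFSMI_of_propV hV ψ hD hψ h0)
    (fun {_ _} α hP {_} δ χ hfac => N.exists_factor_pullback π α hP δ χ hfac)
    (fun α hP hD => N.isFSMI_of_isPullbackMorphism_fst_of_propVII π hVII α hP hD)
    haD ha₀ φ hφ hφiso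

/-- **[FrdII] Prop. 3.4 (viii) for `F = N`: "`N` is of FSMFF-type" (revised 2024 notion)** from the
printed inputs by name — condition (a) as above, condition (b) by the chain bound
(`ArchFrd.Tower.exists_headedChain_bound`: the FSMI clause of (vi) from (vi) proper — `N.propVI` — and (iii), the FSMI half of
(iv), condition (b) for `D` and for `N0` at image objects). [cite: MochizukiFrdII2008, Prop 3.4 (viii) p.33] -/
theorem N.isOfFSMFFType2024 (hIII : (towerN π).PropIII) (hIV : (towerN π).PropIV)
    (hc : RC.IsComplexifiable (π ⋙ D0.toArchBase)) (hV : (towerN π).PropV)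
    (hVII : (towerN π).PropVII) (hD : IsOfFSMFFType2024 D)
    (h10 : ∀ {U V : N0} (ε : U ⟶ V), IsFSMI ε → PreFrobenioid.IsBaseIso C0.toElem (N0.homCarrier ε))
    (ha₀ : ∀ {X Z : (towerN π).F} (ψ₀ : (towerN π).toF0.obj X ⟶ (towerN π).toF0.obj Z),
      IsFSM ψ₀ → ¬ IsIso ψ₀ → ∃ n, IsFSMIChain ψ₀ n)
    (hb₀ : ∀ X : (towerN π).F, ∃ N : ℕ, ∀ {B : (towerN π).F0} (ψ₀ : (towerN π).toF0.obj X ⟶ B)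
      (n : ℕ), IsHeadedFSMIChain ⊤ ψ₀ n → n ≤ N) :
    IsOfFSMFFType2024 (towerN π).F :=
  (towerN π).isOfFSMFFType2024_of_pieces
    (fun φ hφ hφiso => N.exists_isFSMIChain_of_isFSM π hIII hIV hc hV hVII h10 hD.factors ha₀ φ hφ hφiso)
    ((towerN π).exists_headedChain_bound
      ((towerN π).propVI_FSMI_of_propVI_of_propIII (N.propVI π) hIII)
      (fun φ hφ hiso => (towerN π).isFSMI_toF0_of_propIV hIV hc φ hφ hiso)
      (fun _ => hD.bounded _) hb₀)

/-- **[FrdII] Prop. 3.4 (viii) for `F = N`: the conjunct "`F` is of FSMFF-type" of the typed item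
`(towerN π).PropVIII`** (2008 notion, `IsOfFSMFFType (N π)`), from the same named inputs.
[cite: MochizukiFrdII2008, Prop 3.4 (viii) p.30] -/
theorem N.isOfFSMFFType (hIII : (towerN π).PropIII) (hIV : (towerN π).PropIV)
    (hc : RC.IsComplexifiable (π ⋙ D0.toArchBase)) (hV : (towerN π).PropV)
    (hVII : (towerN π).PropVII) (hD : IsOfFSMFFType2024 D)
    (h10 : ∀ {U V : N0} (ε : U ⟶ V), IsFSMI ε → PreFrobenioid.IsBaseIso C0.toElem (N0.homCarrier ε))
    (ha₀ : ∀ {X Z : (towerN π).F} (ψ₀ : (towerN π).toF0.obj X ⟶ (towerN π).toF0.obj Z),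
      IsFSM ψ₀ → ¬ IsIso ψ₀ → ∃ n, IsFSMIChain ψ₀ n)
    (hb₀ : ∀ X : (towerN π).F, ∃ N : ℕ, ∀ {B : (towerN π).F0} (ψ₀ : (towerN π).toF0.obj X ⟶ B)
      (n : ℕ), IsHeadedFSMIChain ⊤ ψ₀ n → n ≤ N) :
    IsOfFSMFFType (N π) :=
  (N.isOfFSMFFType2024 π hIII hIV hc hV hVII hD h10 ha₀ hb₀).isOfFSMFFType

end ArchFrd

end

end Literature.AlgebraicGeometry.Frobenioids
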